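import Mathlib.RingTheory.MvPolynomial.Basic
import Mathlib.Algebra.CharP.Lemmas
import Mathlib.Data.Nat.Choose.Dvd
import Mathlib.Algebra.MvPolynomial.Basic
import HarnessLib

/-!
# The characteristic-`p` expansion of `(yz + f)^(p^e − 1)` (suspension calibration, lead stub)

Support file for crux stmt-ResolutionOfSingularities-15317 (`FrobeniusLadder.FRationalResolution`),
line `Sketch`, continuation seat c2: the by-product "suspension calibration" (every hyperbolic
suspension `yz + f = 0` is in the residual class of the crux). This file proves the binomial input of
the coefficient identity `stub_suspensionCoeff`:

* `choose_prime_pow_sub_one_cast` — `C(p^e − 1, j) = (−1)^j` in any ring of characteristic `p`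
  (`j < p^e`), from Pascal's rule and `p ∣ C(p^e, j+1)`;
* `stub_suspension_pow_expand` — in `A[y,z] = MvPolynomial (Fin 2) A`,
  `(yz + f)^(p^e − 1) = Σ_{j < p^e} (−1)^j f^(p^e − 1 − j) · y^j z^j`.
-/

-- single-problem summit: the doubled namespace component `ResolutionOfSingularities` is forced
set_option linter.dupNamespace false

namespace Summit.ResolutionOfSingularities.ResolutionOfSingularities.Theorems.FRationalResolution

open MvPolynomial
open scoped BigOperators

/-- `C(p^e − 1, j) ≡ (−1)^j (mod p)` for `j < p^e`, as an identity in a ring of characteristic `p`: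
Pascal `C(p^e, j+1) = C(p^e−1, j) + C(p^e−1, j+1)` and `p ∣ C(p^e, j+1)` for `0 < j+1 < p^e`. -/
theorem choose_prime_pow_sub_one_cast (p : ℕ) [hp : Fact p.Prime] (A : Type*) [CommRing A] [CharP A p]
    (e j : ℕ) (hj : j < p ^ e) : (((p ^ e - 1).choose j : ℕ) : A) = (-1) ^ j := by
  induction j with
  | zero => simp
  | succ j ih =>
    have hj' : j < p ^ e := Nat.lt_of_succ_lt hj
    have hq1 : 1 ≤ p ^ e := Nat.one_le_pow _ _ hp.out.pos
    -- Pascal: `C(q, j+1) = C(q-1, j) + C(q-1, j+1)` with `q = p^e`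
    have hpascal : (p ^ e).choose (j + 1) = (p ^ e - 1).choose j + (p ^ e - 1).choose (j + 1) := by
      have := Nat.choose_succ_succ (p ^ e - 1) j
      rwa [Nat.succ_eq_add_one, Nat.sub_add_cancel hq1] at this
    -- `p ∣ C(p^e, j+1)` since `0 < j+1 < p^e`
    have hdvd : p ∣ (p ^ e).choose (j + 1) :=
      hp.out.dvd_choose_pow (Nat.succ_ne_zero j) (Nat.ne_of_lt hj)
    have hzero : (((p ^ e).choose (j + 1) : ℕ) : A) = 0 := (CharP.cast_eq_zero_iff A p _).mpr hdvd
    have h1 : (((p ^ e - 1).choose (j + 1) : ℕ) : A) =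
        (((p ^ e).choose (j + 1) : ℕ) : A) - (((p ^ e - 1).choose j : ℕ) : A) := by
      rw [hpascal, Nat.cast_add]; ring
    rw [h1, hzero, ih hj', zero_sub, pow_succ]
    ring

/-- **The expansion** `(yz + f)^(p^e − 1) = Σ_{j < p^e} (−1)^j f^(p^e−1−j) y^j z^j` in
`A[y,z] = MvPolynomial (Fin 2) A` (`y = X 0`, `z = X 1`) over any commutative ring `A` of
characteristic `p` (binomial theorem + `choose_prime_pow_sub_one_cast`). Registered lead stub of the
suspension calibration, crux stmt-ResolutionOfSingularities-15317, line `Sketch`. -/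
theorem stub_suspension_pow_expand (p : ℕ) [Fact p.Prime] (A : Type) [CommRing A] [CharP A p] (f : A)
    (e : ℕ) :
    (MvPolynomial.X 0 * MvPolynomial.X 1 + MvPolynomial.C f : MvPolynomial (Fin 2) A) ^ (p ^ e - 1)
      = ∑ j ∈ Finset.range (p ^ e), MvPolynomial.monomial (Finsupp.single 0 j + Finsupp.single 1 j)
          ((-1) ^ j * f ^ (p ^ e - 1 - j)) := by
  have hq1 : 1 ≤ p ^ e := Nat.one_le_pow _ _ (Fact.out : p.Prime).pos
  rw [add_pow, Nat.sub_add_cancel hq1]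
  refine Finset.sum_congr rfl fun j hj => ?_
  have hjq : j < p ^ e := Finset.mem_range.mp hj
  have hcast : (((p ^ e - 1).choose j : ℕ) : MvPolynomial (Fin 2) A) = C ((-1) ^ j : A) := by
    rw [← map_natCast (C : A →+* MvPolynomial (Fin 2) A), choose_prime_pow_sub_one_cast p A e j hjq]
  rw [hcast, mul_pow, X_pow_eq_monomial, X_pow_eq_monomial, monomial_mul, ← C_pow, mul_assoc,
    ← C_mul, mul_comm, C_mul_monomial]
  congr 1
  ring
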